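/-
Copyright (c) 2026 the pub-hodgecm-mathlib formalisation cell (harness21).  Prover seat hodgecm-mathlib-K2E4-p23 (g2), Track B ∕ K2-LIT, h413 =
`stmt-HodgeConjecture-24833`, line `K2_E1_TraceFormulaBeta`, socket chain 5Res ∕ 12R3; DEAL (58)(e) of the dealer K2E1-plan (g6) 2026-09-04T10:17:57Z on this seat's
census (45c) «5Res SOCKET-CHAIN» (K2 bus 10:16:55Z): the road-independent finiteness brick (e) of the per-`K`-type campaign «BL-2(χ,τ) ∘ MS-2(χ,τ) ∘ ARCH-UNITARITY ∘ R8₂».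
-/
import Literature.NumberTheory.NumberFields.IdeleOpenSubgroupFiniteIndex     -- ★ `finiteIndex_of_isOpen_of_principalIdeles_le` (open subgroups of `C_K` have finite index)
import Literature.NumberTheory.GaloisRepresentations.HeckeCharacterOfRayClass -- ★ `HeckeCharacter`, `infiniteIdeles`, `ideleGroup.finPart`
import HarnessLib

/-!
# K2·E1 — `K2E1IdeleClassCharactersFiniteOfType`: ONLY FINITELY MANY IDELE CLASS CHARACTERS HAVE A PRESCRIBED RESTRICTION TO AN OPEN SUBGROUP
# (finiteness of the cuspidal data `χ` of a given `K`-type on the Borel Levi `T(𝔸)∕T(F) = 𝔸_Lˣ∕Lˣ` — brick (e) of the 5Res campaign)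

Track B ∕ K2-LIT, crux h413 = `stmt-HodgeConjecture-24833`, route of record `HCCMUnconditional`; cell `hodgecm-mathlib`, squad K2, ENGINE E1 (socket module
`K2_E1_TraceFormulaBetaSigs_GlobalIndex` ED. 12, live socket 5Res `sig_K2E1ResidualCompactU2` :247 = ★ `CmResidualSpectrumCompact L 2 μ`, read today as «⟸ (H4-b) exponent
finiteness per `K`-type» by ★ p857196).  Prover seat `hodgecm-mathlib-K2E4-p23` (g2); DEAL (58)(e) of the dealer K2E1-plan (g6).  THEOREMS ONLY (no `def`, no `instance`, no notation,
no named-fact hypothesis, no `sorry`); lane `--supports stmt-HodgeConjecture-24833 --as helper` (count-neutral).  CLOSES NO SOCKET.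

WHY (census (45c), K2 bus 2026-09-04T10:16:55Z).  The T-clause of (H4-b) at a `K`-type `E` says «only finitely many irreducible `Π ≤ L²_res(U(Φ₂))` contain `E`»; the residual `Π`
are quotients of `I(χ, z₀)` for idele class characters `χ` of `L` (the cuspidal data on the Borel Levi `T ≅ Res_{L∕L⁺} 𝔾_m`) and real poles `z₀ ∈ (½, 1]`.  Maass–Selberg makes the
residues unitary, archimedean unitarity forces `χ` to be trivial on `(L_∞ˣ)⁰` (after the split-component normalisation), the `K_∞ ∩ T`-type and the `K_f`-level of `E` prescribe `χ` on
a compact-open subgroup — so the surviving `χ` have a PRESCRIBED RESTRICTION TO AN OPEN SUBGROUP `U ≤ 𝕀_L`, and this file proves there are only finitely many such `χ`.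

WHAT (any number field `K`; ★ currency `Literature.NumberTheory.GaloisRepresentations`: `ideleGroup K = (AdeleRing (𝓞 K) K)ˣ`, `principalIdeles K`, `HeckeCharacter K` = continuous
`χ : 𝕀_K →ₜ* ℂˣ` trivial on `Kˣ`, a `CommGroup`; `infiniteIdeles K : (K ⊗ ℝ)ˣ →* 𝕀_K`, `ideleGroup.finPart K : 𝕀_K →* (𝔸_K^∞)ˣ`).
* §1 `map_eq_one_of_mem_sup` — a Hecke character trivial on `U` is trivial on `Kˣ·U`; `map_pow_index_eq_one` — hence `χ(x)^{[𝕀_K : KˣU]} = 1`.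
* §2 **`finite_setOf_heckeCharacter_eq_one_on`** — for an OPEN subgroup `U ≤ 𝕀_K`, `{χ : HeckeCharacter K | ∀ u ∈ U, χ u = 1}` is FINITE: `T := Kˣ ⊔ U` is open and contains `Kˣ`, so
  has finite index `n` (★ `finiteIndex_of_isOpen_of_principalIdeles_le` — Tate's remark «every open subgroup of `C_K` has finite index», i.e. compactness of `C_K¹`); a character
  trivial on `T` is determined by its values on representatives of `𝕀_K ∕ T`, which are `n`-th roots of unity — finitely many functions.
* §3 **`finite_setOf_heckeCharacter_eq_on`** — the COSET form: for any `ρ : 𝕀_K → ℂˣ`, `{χ | ∀ u ∈ U, χ u = ρ u}` is finite (a translate of §2 or empty).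
* §4 **`finite_setOf_heckeCharacter_arch_eq_level`** — the CONSUMER form: prescribed archimedean component `Φ : (K ⊗ ℝ)ˣ → ℂˣ` and triviality on the ideles with
  archimedean part `1` and finite part in an open `U_f ≤ (𝔸_K^∞)ˣ` leave only finitely many Hecke characters (§3 with `U := U_f.comap finPart`).
For the CM field `L` of the line (all archimedean places complex, `L_∞ˣ` connected) §4 is literally the finiteness used by ARCH-UNITARITY; §2∕§3 serve any open `U`.
HONEST LABEL: HC_CM is proved only modulo the 7 printed citations (2 remaining named inputs: hLiu418 = `stmt-HodgeConjecture-24832`, h413 = `stmt-HodgeConjecture-24833`) until rung 0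
closes; this file asserts no named fact and closes no socket; count-neutral.
References: [CasselsFrohlichANT1967] J. Tate, *Global class field theory*, in Cassels–Fröhlich (1967), Ch. VII §5.1 remark after (D) · [WeilBNT1967] A. Weil, *Basic Number Theory*
(1967), Ch. IV §4 Thm. 6 · [Neukirch1999] J. Neukirch, *Algebraic Number Theory* (1999), Ch. VI §1 (1.7)–(1.9), Ch. VII §6 (6.1) · [MoeglinWaldspurger1995] I.2.18, V.3.13.
-/

set_option autoImplicit false
-- the mandated namespace repeats the single-problem summit's segment (`HodgeConjecture.HodgeConjecture`)
set_option linter.dupNamespace false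

noncomputable section

open NumberField Topology Set
open Literature.NumberTheory.GaloisRepresentations Literature.NumberTheory.NumberFields

namespace Summit.HodgeConjecture.HodgeConjecture.Cruxes.H413.K2E1IdeleClassCharactersFiniteOfType

variable {K : Type} [Field K] [NumberField K]

/-! ## §1 Characters trivial on `U` are trivial on `Kˣ ⊔ U`, hence have values of finite order -/

/-- A Hecke character trivial on the subgroup `U ≤ 𝕀_K` is trivial on `Kˣ ⊔ U` (it is trivial on principal ideles by definition). [folklore] -/
theorem map_eq_one_of_mem_sup {U : Subgroup (ideleGroup K)} {χ : HeckeCharacter K} (hχ : ∀ u ∈ U, χ u = 1)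
    {x : ideleGroup K} (hx : x ∈ principalIdeles K ⊔ U) : χ x = 1 := by
  obtain ⟨y, hy, z, hz, rfl⟩ := Subgroup.mem_sup.1 hx
  rw [map_mul, χ.map_principal hy, hχ z hz, one_mul]

/-- If `χ` is trivial on `U`, then `χ(x)^n = 1` for every idele `x`, where `n = [𝕀_K : Kˣ ⊔ U]` is the index (Mathlib: `0` if infinite, then trivially). [folklore] -/
theorem map_pow_index_eq_one {U : Subgroup (ideleGroup K)} {χ : HeckeCharacter K} (hχ : ∀ u ∈ U, χ u = 1) (x : ideleGroup K) :
    χ x ^ (principalIdeles K ⊔ U).index = 1 := by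
  rw [← map_pow]
  exact map_eq_one_of_mem_sup hχ ((principalIdeles K ⊔ U).pow_index_mem x)

/-- Two Hecke characters trivial on `U` that agree on a set of representatives of `𝕀_K ∕ (Kˣ ⊔ U)` (the `Quotient.out` section) are equal. [folklore] -/
theorem eq_of_forall_out_eq {U : Subgroup (ideleGroup K)} {χ ψ : HeckeCharacter K} (hχ : ∀ u ∈ U, χ u = 1) (hψ : ∀ u ∈ U, ψ u = 1)
    (h : ∀ q : ideleGroup K ⧸ (principalIdeles K ⊔ U), χ q.out = ψ q.out) : χ = ψ := by
  ext x
  obtain ⟨t, ht⟩ := QuotientGroup.mk_out_eq_mul (principalIdeles K ⊔ U) x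
  have hx : x = (QuotientGroup.mk x : ideleGroup K ⧸ (principalIdeles K ⊔ U)).out * (t : ideleGroup K)⁻¹ := by
    rw [ht, mul_inv_cancel_right]
  have key := h (QuotientGroup.mk x)
  rw [hx, map_mul, map_mul, map_inv, map_inv, map_eq_one_of_mem_sup hχ t.2, map_eq_one_of_mem_sup hψ t.2, key]

/-! ## §2 The group form: only finitely many Hecke characters are trivial on a given open subgroup -/

/-- **FINITELY MANY IDELE CLASS CHARACTERS ARE TRIVIAL ON A GIVEN OPEN SUBGROUP.**  For a number field `K` and an OPEN subgroup `U ≤ 𝕀_K`, the set of Hecke characters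
(continuous `χ : 𝕀_K → ℂˣ`, `χ(Kˣ) = 1`) with `χ|_U = 1` is finite: `Kˣ ⊔ U` is open and contains `Kˣ`, hence has finite index `n` («every open subgroup of `C_K` has finite
index» — compactness of `C_K¹`, ★ `finiteIndex_of_isOpen_of_principalIdeles_le`), and such `χ` is determined by its values on the finitely many representatives of `𝕀_K ∕ (Kˣ ⊔ U)`,
each an `n`-th root of unity.  (Dual statement: the character group of the finite ray-class-type group `𝕀_K ∕ Kˣ U` is finite.)
[cite: CasselsFrohlichANT1967, Ch. VII §5.1, remark after (D)] [cite: WeilBNT1967, Ch. IV §4, Thm. 6] -/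
theorem finite_setOf_heckeCharacter_eq_one_on (U : Subgroup (ideleGroup K)) (hU : IsOpen (U : Set (ideleGroup K))) :
    {χ : HeckeCharacter K | ∀ u ∈ U, χ u = 1}.Finite := by
  set T : Subgroup (ideleGroup K) := principalIdeles K ⊔ U with hT
  have hTo : IsOpen (T : Set (ideleGroup K)) := Subgroup.isOpen_mono le_sup_right hU
  haveI hTi : T.FiniteIndex := finiteIndex_of_isOpen_of_principalIdeles_le T hTo le_sup_left
  haveI : Finite (ideleGroup K ⧸ T) := Subgroup.finite_quotient_of_finiteIndex
  haveI : NeZero T.index := ⟨Subgroup.FiniteIndex.index_ne_zero⟩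
  -- the values of a character trivial on `T` on the representatives: a function `𝕀_K ∕ T → {n-th roots of unity}`
  let F : HeckeCharacter K → (ideleGroup K ⧸ T) → ℂˣ := fun χ q => χ q.out
  have hroots : ((rootsOfUnity T.index ℂ : Subgroup ℂˣ) : Set ℂˣ).Finite :=
    @Set.toFinite ℂˣ _ (inferInstanceAs (Finite (rootsOfUnity T.index ℂ)))
  have himage : F '' {χ : HeckeCharacter K | ∀ u ∈ U, χ u = 1} ⊆ Set.pi Set.univ fun _ => ((rootsOfUnity T.index ℂ : Subgroup ℂˣ) : Set ℂˣ) := by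
    rintro _ ⟨χ, hχ, rfl⟩
    refine Set.mem_univ_pi.2 fun q => ?_
    show χ q.out ∈ rootsOfUnity T.index ℂ
    rw [mem_rootsOfUnity]
    exact map_pow_index_eq_one hχ q.out
  refine Set.Finite.of_finite_image ((Set.Finite.pi fun _ => hroots).subset himage) ?_
  intro χ hχ ψ hψ hF
  exact eq_of_forall_out_eq hχ hψ fun q => congr_fun hF q

/-! ## §3 The coset form: prescribed restriction to an open subgroup -/

/-- **FINITELY MANY IDELE CLASS CHARACTERS HAVE A PRESCRIBED RESTRICTION TO AN OPEN SUBGROUP.**  For an open subgroup `U ≤ 𝕀_K` and ANY function `ρ : 𝕀_K → ℂˣ`, only finitely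
many Hecke characters `χ` satisfy `χ u = ρ u` for all `u ∈ U` (the set is empty or a translate of the finite group of §2 by one of its members).
[cite: CasselsFrohlichANT1967, Ch. VII §5.1, remark after (D)] [cite: WeilBNT1967, Ch. IV §4, Thm. 6] -/
theorem finite_setOf_heckeCharacter_eq_on (U : Subgroup (ideleGroup K)) (hU : IsOpen (U : Set (ideleGroup K))) (ρ : ideleGroup K → ℂˣ) :
    {χ : HeckeCharacter K | ∀ u ∈ U, χ u = ρ u}.Finite := by
  rcases Set.eq_empty_or_nonempty {χ : HeckeCharacter K | ∀ u ∈ U, χ u = ρ u} with h0 | ⟨χ₀, hχ₀⟩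
  · rw [h0]
    exact Set.finite_empty
  · refine Set.Finite.of_finite_image ((finite_setOf_heckeCharacter_eq_one_on U hU).subset ?_) (f := fun χ => χ * χ₀⁻¹) ?_
    · rintro _ ⟨χ, hχ, rfl⟩ u hu
      show (χ * χ₀⁻¹) u = 1
      rw [HeckeCharacter.mul_apply, HeckeCharacter.inv_apply, hχ u hu, hχ₀ u hu, mul_inv_cancel]
    · intro χ _ ψ _ h
      exact mul_right_cancel (a := χ) (b := χ₀⁻¹) (c := ψ) h

/-! ## §4 The consumer form: prescribed archimedean component and finite level -/

/-- The archimedean-times-finite splitting of an idele: `x = ι_∞(x_∞) · x_f` where `x_f := x · ι_∞(x_∞)⁻¹` has archimedean component `1` and the same finite part as `x`. [folklore] -/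
theorem fst_mul_infiniteIdeles_inv_eq_one (x : ideleGroup K) :
    ((x * (infiniteIdeles K (Units.map (RingHom.fst (InfiniteAdeleRing K) (IsDedekindDomain.FiniteAdeleRing (𝓞 K) K)).toMonoidHom x))⁻¹ : ideleGroup K) :
      AdeleRing (𝓞 K) K).1 = 1 := by
  show (x : AdeleRing (𝓞 K) K).1 * ((x⁻¹ : ideleGroup K) : AdeleRing (𝓞 K) K).1 = 1
  have h : ((x : AdeleRing (𝓞 K) K) * ((x⁻¹ : ideleGroup K) : AdeleRing (𝓞 K) K)).1 = (1 : AdeleRing (𝓞 K) K).1 := by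
    rw [Units.mul_inv]
  exact h

/-- The finite part of `x · ι_∞(x_∞)⁻¹` is the finite part of `x`. [folklore] -/
theorem finPart_mul_infiniteIdeles_inv (x : ideleGroup K) :
    ideleGroup.finPart K (x * (infiniteIdeles K (Units.map (RingHom.fst (InfiniteAdeleRing K) (IsDedekindDomain.FiniteAdeleRing (𝓞 K) K)).toMonoidHom x))⁻¹) =
      ideleGroup.finPart K x := by
  rw [map_mul, map_inv]
  have : ideleGroup.finPart K (infiniteIdeles K (Units.map (RingHom.fst (InfiniteAdeleRing K) (IsDedekindDomain.FiniteAdeleRing (𝓞 K) K)).toMonoidHom x)) = 1 :=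
    Units.ext rfl
  rw [this, inv_one, mul_one]

/-- The finite-part homomorphism `𝕀_K → (𝔸_K^∞)ˣ` is continuous. [folklore] -/
theorem continuous_finPart : Continuous (ideleGroup.finPart K) :=
  Continuous.units_map _ continuous_snd

/-- **THE CONSUMER FORM (brick (e) of the 5Res campaign): PRESCRIBED ARCHIMEDEAN COMPONENT AND FINITE LEVEL LEAVE FINITELY MANY HECKE CHARACTERS.**  For a number field `K`,
ANY prescribed archimedean component `Φ : (K ⊗ ℝ)ˣ → ℂˣ` and an OPEN subgroup `U_f` of the finite ideles `(𝔸_K^∞)ˣ` (a level), only finitely many Hecke characters `χ` of `K` satisfy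
`χ(ι_∞ a) = Φ a` for all `a ∈ (K ⊗ ℝ)ˣ` and `χ x = 1` for every idele `x` with archimedean component `1` and finite part in `U_f`.  (For a CM field all archimedean places are complex, `(K ⊗ ℝ)ˣ`
is connected, and this is exactly the finiteness of the cuspidal data `χ` on the Borel Levi of `U(Φ₂)` with a given `K_∞ ∩ T`-type and `K_f`-level that survive archimedean unitarity —
the pole COUNT of the residual spectrum per `K`-type needs no `L`-function.)  Proof: §3 with `U := U_f.comap finPart` (open by continuity) and `ρ := Φ ∘ (archimedean part)`.
[cite: CasselsFrohlichANT1967, Ch. VII §5.1, remark after (D)] [cite: MoeglinWaldspurger1995, I.2.18 and V.3.13] -/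
theorem finite_setOf_heckeCharacter_arch_eq_level (Φ : (InfiniteAdeleRing K)ˣ → ℂˣ)
    (Uf : Subgroup (IsDedekindDomain.FiniteAdeleRing (𝓞 K) K)ˣ) (hUf : IsOpen (Uf : Set (IsDedekindDomain.FiniteAdeleRing (𝓞 K) K)ˣ)) :
    {χ : HeckeCharacter K | (∀ a : (InfiniteAdeleRing K)ˣ, χ (infiniteIdeles K a) = Φ a) ∧
      ∀ x : ideleGroup K, ((x : ideleGroup K) : AdeleRing (𝓞 K) K).1 = 1 → ideleGroup.finPart K x ∈ Uf → χ x = 1}.Finite := by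
  refine (finite_setOf_heckeCharacter_eq_on (Uf.comap (ideleGroup.finPart K)) (hUf.preimage continuous_finPart)
    (fun x => Φ (Units.map (RingHom.fst (InfiniteAdeleRing K) (IsDedekindDomain.FiniteAdeleRing (𝓞 K) K)).toMonoidHom x))).subset ?_
  rintro χ ⟨harch, hlev⟩ u hu
  -- `u = ι_∞(u_∞) · u_f` with `u_f` of archimedean part `1` and finite part `finPart u ∈ U_f`
  set a := Units.map (RingHom.fst (InfiniteAdeleRing K) (IsDedekindDomain.FiniteAdeleRing (𝓞 K) K)).toMonoidHom u with ha
  have hsplit : infiniteIdeles K a * (u * (infiniteIdeles K a)⁻¹) = u := by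
    rw [← mul_assoc, mul_comm (infiniteIdeles K a) u, mul_assoc, mul_inv_cancel, mul_one]
  have hfin : ideleGroup.finPart K (u * (infiniteIdeles K a)⁻¹) ∈ Uf := by
    rw [ha, finPart_mul_infiniteIdeles_inv]
    exact Subgroup.mem_comap.1 hu
  have h1 : χ (u * (infiniteIdeles K a)⁻¹) = 1 := hlev _ (by rw [ha]; exact fst_mul_infiniteIdeles_inv_eq_one u) hfin
  show χ u = Φ a
  rw [← hsplit, map_mul, harch a, h1, mul_one]

end Summit.HodgeConjecture.HodgeConjecture.Cruxes.H413.K2E1IdeleClassCharactersFiniteOfType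

end
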